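import Summits.BirchSwinnertonDyer.BirchSwinnertonDyer.Theorems.KolyvaginRankRigidityAtTwoTriangularSystem
import Literature.NumberTheory.EllipticCurves.SelmerLevelToPrimary
import HarnessLib

/-!
# Crux V2♭ `KolyvaginCorankLowerBoundAtTwo` (stmt-BirchSwinnertonDyer-24623), line `kolyvagin_depth_split`:
# triangular systems AT LEVEL `2^M` — in `H¹(K, E[2^M])`, tested by LOCALISATION KERNELS — give the
# corank lower bound

Kolyvagin 1991 (Math. Ann. 291), proof of Thm. 2.2: the classes `η_i = τ_{p_i ⋯ p_{i+f-1}, n'}`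
(`1 ≤ i ≤ f + 1`) live at ONE level `M = ℓ^{n'}` in `H¹(K, E_M)`, and the test functionals are the
localisations `ψ_{p_{f+j}}` at the auxiliary Kolyvagin primes; `R_{ij} = 0` for `j < i` and
`R_{ii}` has large order. This file supplies the form of that step which the line's skeleton
consumes at `p = 2`, entirely in the tree's KERNEL currency (no finite/singular splitting of
`H¹(K_λ, E[2^M])` is needed):

* `lowerBound_of_levelTriangularSystems` — if for every `M` there are `ν + 1` classes
  `η_i ∈ Sel^{(2^M)}(E/K) ⊆ H¹(K, E[2^M])`, eigenvectors of complex conjugation with one common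
  sign `ε` (`conjAct`), places `v_0, …, v_ν` of `K` with `η_i` LOCALLY TRIVIAL at `v_j` for
  `j < i` (`torsionLocalKer`) and `η_i` of local order `≥ 2^{M-d}` at `v_i`
  (`2^e η_i ∉ torsionLocalKer v_i` for `e + d < M`), then
  `ν + 1 ≤ corank Sel_{2^∞}(E/ℚ) ∨ ν + 1 ≤ corank Sel_{2^∞}(E^{(d_K)}/ℚ)`.

Proof: the quotient maps `H¹(K, E[2^M]) → H¹(K, E[2^M]) ⧸ ker(loc_{v_j})` form an upper-triangular
test system, so `pow_le_natCard_closure_of_triangular` (p596817) bounds the span of the `η_i` from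
below; the span is pushed into `Sel_{2^∞}(E/K)` along `H¹(K, E[2^M]) → H¹(K, E[2^∞])`
(`torsionPowToPrimaryH1`, injective as `E(K)[2] = 0`, Selmer to Selmer, compatible with the
conjugation actions — `torsionPowToPrimaryH1_conjH1`, proved here), and
`lowerBound_of_eigenGrowthOverK` (p596499, with p595706) reads the coranks over `ℚ`.
HONEST FRAMING: pure bookkeeping; the EXISTENCE of such systems of Heegner classes at the minimal
depth (Kolyvagin's Thm. 2.2 at the prime `2`) is the research content of the line and is NOT
proved here; BSD is not proved; V2♭ stays open.
-/

set_option autoImplicit false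
-- the Theorems namespace of this sub repeats the summit name by design (D-0017 nested layout)
set_option linter.dupNamespace false

noncomputable section

open scoped Classical AddSubgroup

open AddSubgroup WeierstrassCurve Literature.NumberTheory.EllipticCurves
  Literature.NumberTheory.GaloisRepresentations NumberField IsDedekindDomain
open Summit.BirchSwinnertonDyer.BirchSwinnertonDyer.Theorems.KolyvaginRankRigidity

namespace Summit.BirchSwinnertonDyer.BirchSwinnertonDyer.Theorems.KolyvaginLowerBoundAtTwo

universe u

/-! ## `H¹(K, E[p^M]) → H¹(K, E[p^∞])` commutes with complex conjugation -/

section Compat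

variable {K : Type u} [Field K] [CharZero K] (W : WeierstrassCurve ℚ) (p M : ℕ)
  {σ : K ≃ₐ[ℚ] K} {τ : AlgebraicClosure K ≃+* AlgebraicClosure K}

/-- **The level-`p^M` → `p^∞` comparison commutes with the conjugation actions**: for a lift `τ`
of `σ ∈ Aut(K/ℚ)`, `ι_* ∘ τ_* = τ_* ∘ ι_*` on `H¹(K, E[p^M]) → H¹(K, E[p^∞])`, both being the map of
the compatible pair `(conjGalCMH, E[p^M] ↪ E[p^∞] → E[p^∞])` (functoriality of `H¹`).
Serre, *Galois Cohomology*, I.§2.4; Gross 1991, §5 (5.1). [folklore] -/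
theorem torsionPowToPrimaryH1_conjH1 (hτ : IsLiftOfAut σ τ)
    (y : galH1Torsion (W.baseChange K) ((p ^ M : ℕ) : ℤ)) :
    torsionPowToPrimaryH1 (W.baseChange K) p M (hτ.conjH1 W ((p ^ M : ℕ) : ℤ) y) =
      hτ.conjH1Primary W p (torsionPowToPrimaryH1 (W.baseChange K) p M y) := by
  change torsionPowToPrimaryH1 (W.baseChange K) p M
      (resH1Hom hτ.conjGalCMH (hτ.torsionMap W ((p ^ M : ℕ) : ℤ))
        (hτ.torsionMap_smul W ((p ^ M : ℕ) : ℤ)) y) = _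
  rw [torsionPowToPrimaryH1, IsLiftOfAut.conjH1Primary, resH1Hom_resH1Hom, resH1Hom_resH1Hom]
  exact congrFun (congrArg DFunLike.coe (resH1Hom_congr (by ext; rfl)
    (by ext P; rfl) _ _)) y

/-- `conjAct` form of `torsionPowToPrimaryH1_conjH1` (the action of `σ ∈ Aut(K/ℚ)` through its
chosen lift). [folklore] -/
theorem torsionPowToPrimaryH1_conjAct (σ₀ : K ≃ₐ[ℚ] K)
    (y : galH1Torsion (W.baseChange K) ((p ^ M : ℕ) : ℤ)) :
    torsionPowToPrimaryH1 (W.baseChange K) p M (conjAct W σ₀ ((p ^ M : ℕ) : ℤ) y) =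
      (isLiftOfAut_liftAut σ₀).conjH1Primary W p (torsionPowToPrimaryH1 (W.baseChange K) p M y) :=
  torsionPowToPrimaryH1_conjH1 W p M (isLiftOfAut_liftAut σ₀) y

end Compat

/-! ## Elementary: `H¹(K, E[p^M])` is killed by `p^M`; local orders read from kernels -/

/-- `H¹(F, E[p^M])` is killed by `p^M` (the coefficients are). [folklore] -/
theorem pow_nsmul_galH1Torsion {F : Type u} [Field F] (W' : WeierstrassCurve F) (p M : ℕ)
    (y : galH1Torsion W' ((p ^ M : ℕ) : ℤ)) : p ^ M • y = 0 := by
  obtain ⟨φ, rfl⟩ := oneCocycleClass_surjective _ y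
  exact nsmul_oneCocycleClass_eq_zero φ (p ^ M) (fun g ↦ AddSubgroup.torsionBy.nsmul _)

/-- **Local order from the kernel currency.** If `2^M x = 0` and `2^e x ∉ N` whenever
`e + d < M`, then the image of `x` in `B ⧸ N` has order at least `2^{M-d}` (its order is a power
`2^a` with `2^a x ∈ N`, so `a + d ≥ M`). Used with `N = ker (H¹(K, E[2^M]) → H¹(K_v, E[2^M]))`,
where "`ord x_v ≥ 2^{M-d}`" is spelled `∀ e, e + d < M → 2^e x ∉ N` (McCallum 1991, Cor. 3.2:
`ord c_{i,λ} = p^{N_i}`). [folklore] -/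
theorem pow_sub_le_addOrderOf_mk {B : Type*} [AddCommGroup B] (N : AddSubgroup B) {M d : ℕ}
    {x : B} (hM : 2 ^ M • x = 0)
    (h : ∀ e : ℕ, e + d < M → ((2 ^ e : ℕ) : ℤ) • x ∉ N) :
    2 ^ (M - d) ≤ addOrderOf (QuotientAddGroup.mk' N x) := by
  have hdvd : addOrderOf (QuotientAddGroup.mk' N x) ∣ 2 ^ M :=
    addOrderOf_dvd_of_nsmul_eq_zero (by rw [← map_nsmul, hM, map_zero])
  obtain ⟨a, -, hao⟩ := (Nat.dvd_prime_pow Nat.prime_two).1 hdvd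
  rw [hao]
  refine Nat.pow_le_pow_right (by norm_num) ?_
  by_contra hlt
  have hmem : ((2 ^ a : ℕ) : ℤ) • x ∈ N := by
    rw [natCast_zsmul, ← QuotientAddGroup.eq_zero_iff, ← QuotientAddGroup.mk'_apply, map_nsmul,
      ← hao]
    exact addOrderOf_nsmul_eq_zero _
  exact h a (by omega) hmem

/-! ## The level-`2^M` triangular system gives the corank bound -/

section Main

variable (W : WeierstrassCurve ℚ) [W.IsElliptic] (K : Type) [Field K] [NumberField K]
  (h2 : Module.finrank ℚ K = 2) {θ : K} {c : ℚ} (hθ : θ ∉ Set.range (algebraMap ℚ K))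
  (hc : θ ^ 2 = algebraMap ℚ K c)

include h2 hθ hc in
/-- **Triangular systems of level `2^M` in `H¹(K, E[2^M])` bound the Selmer coranks from below.**
Let `K = ℚ(θ)`, `θ² = c`, with complex conjugation `σ₀ = sigmaQ`, and `E(K)[2] = 0`. Suppose that
for one sign `ε ∈ {1, -1}`, one defect `d`, and EVERY level `M` there are classes
`η_0, …, η_ν ∈ Sel^{(2^M)}(E/K) ⊆ H¹(K, E[2^M])` and finite places `v_0, …, v_ν` of `K` with
* `σ₀_* η_i = ε η_i` (`conjAct`),
* `η_i` locally trivial at `v_j` for `j < i` (`η_i ∈ ker (H¹(K, E[2^M]) → H¹(K_{v_j}, E[2^M]))`),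
* `η_i` of local order `≥ 2^{M-d}` at `v_i` (`2^e η_i ∉ ker (… → H¹(K_{v_i}, E[2^M]))` for
  `e + d < M`).
Then `ν + 1 ≤ corank_{ℤ₂} Sel_{2^∞}(E/ℚ)` or `ν + 1 ≤ corank_{ℤ₂} Sel_{2^∞}(E^{(d_K)}/ℚ)`. This is
the shape of Kolyvagin 1991, Thm. 2.2 (proof: "`R_{ij} = ψ_{p_{f+j}}(η_i)`; `R_{ij} = 0` for
`j < i`; `R_{ii} ∈ ℓ^{m_f}(ℤ/M)^*`; if `Σ α_i η_i = 0` then … `α_i ≡ 0`") followed by §2's passage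
from `S(K, E_M)` to the coranks `r^ν`, at the prime `2` (eigenVECTORS, transfer losses absorbed by
`lowerBound_of_eigenGrowthOverK`). The test system is `φ_j = (H¹(K,E[2^M]) → H¹(K,E[2^M]) ⧸ ker loc_{v_j})`;
the span of the `η_i` has order `≥ 2^{(ν+1)(M-d)}` (`pow_le_natCard_closure_of_triangular`) and is
carried into `Sel_{2^∞}(E/K)` by the injective `H¹(K, E[2^M]) → H¹(K, E[2^∞])`.
[cite: Kolyvagin1991MathAnn, §2 Thm. 2.2 (proof) and Thm. 2.3] [cite: WZhang2014, Lemma 8.4] -/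
theorem lowerBound_of_levelTriangularSystems
    (htor : AddSubgroup.torsionBy (W.baseChange K).toAffine.Point (2 : ℤ) = ⊥)
    (ν d : ℕ) (ε : ℤ) (hε1 : ε = 1 ∨ ε = -1)
    (h : ∀ M : ℕ, ∃ (η : Fin (ν + 1) → galH1Torsion (W.baseChange K) ((2 ^ M : ℕ) : ℤ))
        (v : Fin (ν + 1) → HeightOneSpectrum (𝓞 K)),
      (∀ i, η i ∈ selmerGroup (W.baseChange K) ((2 ^ M : ℕ) : ℤ)) ∧
      (∀ i, conjAct W (sigmaQ K h2 hθ hc) ((2 ^ M : ℕ) : ℤ) (η i) = ε • η i) ∧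
      (∀ i j : Fin (ν + 1), j < i →
        η i ∈ (W.baseChange K).torsionLocalKer ((v j).adicCompletion K) ((2 ^ M : ℕ) : ℤ)) ∧
      (∀ (i : Fin (ν + 1)) (e : ℕ), e + d < M →
        ((2 ^ e : ℕ) : ℤ) • η i ∉
          (W.baseChange K).torsionLocalKer ((v i).adicCompletion K) ((2 ^ M : ℕ) : ℤ))) :
    ν + 1 ≤ W.selmerCorank 2 ∨
      ν + 1 ≤ (W.quadraticTwist (NumberField.discr K : ℚ)).selmerCorank 2 := by
  haveI : Fact (Nat.Prime 2) := ⟨Nat.prime_two⟩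
  haveI : (W.baseChange K).IsElliptic := by rw [baseChange]; infer_instance
  -- eigen-growth inside `Sel_{2^∞}(E/K)` with constant `2^{(ν+1)d}`
  have hgrow : ∀ M, ∃ B : AddSubgroup (galH1Primary (W.baseChange K) 2), Finite B ∧
      B ≤ selmerGroupPInfty (W.baseChange K) 2 ∧
      (∀ b ∈ B, (isLiftOfAut_liftAut (sigmaQ K h2 hθ hc)).conjH1Primary W 2 b = ε • b) ∧
      (∀ b ∈ B, 2 ^ M • b = 0) ∧ 2 ^ ((ν + 1) * M) ≤ 2 ^ ((ν + 1) * d) * Nat.card B := by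
    intro M
    obtain ⟨η, v, hSel, hε, htri, hdiag⟩ := h M
    set f := torsionPowToPrimaryH1 (W.baseChange K) 2 M with hf
    have hfinj : Function.Injective f :=
      torsionPowToPrimaryH1_injective_of_torsionBy_eq_bot (W.baseChange K) 2 M htor
    -- the local kernels and the test maps into the product of the quotients
    set N : Fin (ν + 1) → AddSubgroup (galH1Torsion (W.baseChange K) ((2 ^ M : ℕ) : ℤ)) :=
      fun j ↦ (W.baseChange K).torsionLocalKer ((v j).adicCompletion K) ((2 ^ M : ℕ) : ℤ) with hN
    set φ : Fin (ν + 1) → (galH1Torsion (W.baseChange K) ((2 ^ M : ℕ) : ℤ) →+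
        ((j : Fin (ν + 1)) → galH1Torsion (W.baseChange K) ((2 ^ M : ℕ) : ℤ) ⧸ N j)) :=
      fun j ↦ (AddMonoidHom.single (fun j ↦ galH1Torsion (W.baseChange K) ((2 ^ M : ℕ) : ℤ) ⧸ N j)
        j).comp (QuotientAddGroup.mk' (N j)) with hφ
    -- the span of the `η_i` and its finiteness (through `f` into `Sel_{2^∞}[2^M]`)
    set H := AddSubgroup.closure (Set.range η) with hH
    have hHsel : H ≤ selmerGroup (W.baseChange K) ((2 ^ M : ℕ) : ℤ) :=
      (AddSubgroup.closure_le _).mpr (by rintro _ ⟨i, rfl⟩; exact hSel i)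
    set S := selmerGroupPInfty (W.baseChange K) 2 with hS
    haveI : Finite S[((2 : ℕ) : ℤ)] := finite_torsionBy_selmerGroupPInfty (W.baseChange K) 2
    haveI : Finite S[((2 ^ M : ℕ) : ℤ)] := finite_torsionBy_pow _ 2 M
    have hfin : Finite H := by
      refine Finite.of_injective (fun x : H ↦ (⟨⟨f x,
        torsionPowToPrimaryH1_mem_selmerGroupPInfty _ 2 M (hHsel x.2)⟩,
        torsionBy.nsmul_iff.mpr (Subtype.ext ?_)⟩ : S[((2 ^ M : ℕ) : ℤ)])) ?_
      · rw [AddSubmonoidClass.coe_nsmul, ZeroMemClass.coe_zero]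
        exact pow_nsmul_torsionPowToPrimaryH1 _ 2 M _
      · intro x y hxy
        have hxy' := congrArg
          (fun z : S[((2 ^ M : ℕ) : ℤ)] ↦ ((z : S) : galH1Primary (W.baseChange K) 2)) hxy
        exact Subtype.ext (hfinj hxy')
    -- the triangular count in `H¹(K, E[2^M])`
    have htri' : ∀ i j : Fin (ν + 1), j < i → φ j (η i) = 0 := by
      intro i j hij
      change AddMonoidHom.single (fun j ↦ galH1Torsion (W.baseChange K) ((2 ^ M : ℕ) : ℤ) ⧸ N j) j
        (QuotientAddGroup.mk' (N j) (η i)) = 0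
      rw [QuotientAddGroup.mk'_apply, (QuotientAddGroup.eq_zero_iff _).mpr (htri i j hij), map_zero]
    have hdiag' : ∀ i : Fin (ν + 1), 2 ^ (M - d) ≤ addOrderOf (φ i (η i)) := by
      intro i
      change 2 ^ (M - d) ≤ addOrderOf (AddMonoidHom.single
        (fun j ↦ galH1Torsion (W.baseChange K) ((2 ^ M : ℕ) : ℤ) ⧸ N j) i
        (QuotientAddGroup.mk' (N i) (η i)))
      rw [addOrderOf_injective
        (AddMonoidHom.single (fun j ↦ galH1Torsion (W.baseChange K) ((2 ^ M : ℕ) : ℤ) ⧸ N j) i)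
        (fun a b hab ↦ Pi.single_injective
          (M := fun j ↦ galH1Torsion (W.baseChange K) ((2 ^ M : ℕ) : ℤ) ⧸ N j) i hab)]
      exact pow_sub_le_addOrderOf_mk (N i) (pow_nsmul_galH1Torsion _ 2 M (η i)) (hdiag i)
    have hcard : (2 ^ (M - d)) ^ (ν + 1) ≤ Nat.card H :=
      pow_le_natCard_closure_of_triangular (2 ^ (M - d)) (ν + 1) η φ hfin htri' hdiag'
    -- transport into `H¹(K, E[2^∞])`
    have hεH : ∀ x ∈ H, conjAct W (sigmaQ K h2 hθ hc) ((2 ^ M : ℕ) : ℤ) x = ε • x := by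
      intro x hx
      refine AddSubgroup.closure_induction (fun y hy ↦ ?_) (by rw [map_zero, zsmul_zero])
        (fun a b _ _ ha hb ↦ ?_) (fun a _ ha ↦ ?_) hx
      · obtain ⟨i, rfl⟩ := hy
        exact hε i
      · rw [map_add, ha, hb, zsmul_add]
      · rw [map_neg, ha, zsmul_neg]
    haveI := hfin
    refine ⟨H.map f, ?_, ?_, ?_, ?_, ?_⟩
    · exact Finite.of_surjective (fun x : H ↦ (⟨f x, x, x.2, rfl⟩ : H.map f))
        (by rintro ⟨_, x, hx, rfl⟩; exact ⟨⟨x, hx⟩, rfl⟩)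
    · rintro _ ⟨x, hx, rfl⟩
      exact torsionPowToPrimaryH1_mem_selmerGroupPInfty _ 2 M (hHsel hx)
    · rintro _ ⟨x, hx, rfl⟩
      rw [← map_zsmul, ← hεH x hx, hf, torsionPowToPrimaryH1_conjAct]
    · rintro _ ⟨x, -, rfl⟩
      exact pow_nsmul_torsionPowToPrimaryH1 _ 2 M x
    · rw [AddSubgroup.card_map_of_injective hfinj]
      calc 2 ^ ((ν + 1) * M) ≤ 2 ^ ((ν + 1) * d + (ν + 1) * (M - d)) :=
            Nat.pow_le_pow_right (by norm_num)
              (by rw [← mul_add]; exact Nat.mul_le_mul_left _ (by omega))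
        _ = 2 ^ ((ν + 1) * d) * 2 ^ ((ν + 1) * (M - d)) := pow_add _ _ _
        _ ≤ 2 ^ ((ν + 1) * d) * Nat.card H := by
            refine Nat.mul_le_mul_left _ ?_
            rw [mul_comm, pow_mul]
            exact hcard
  rcases hε1 with rfl | rfl
  · refine lowerBound_of_eigenGrowthOverK W K h2 hθ hc ν (2 ^ ((ν + 1) * d)) (Or.inl fun M ↦ ?_)
    obtain ⟨B, hB1, hB2, hB3, hB4, hB5⟩ := hgrow M
    exact ⟨B, hB1, hB2, fun b hb ↦ by rw [hB3 b hb, one_zsmul], hB4, hB5⟩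
  · refine lowerBound_of_eigenGrowthOverK W K h2 hθ hc ν (2 ^ ((ν + 1) * d)) (Or.inr fun M ↦ ?_)
    obtain ⟨B, hB1, hB2, hB3, hB4, hB5⟩ := hgrow M
    exact ⟨B, hB1, hB2, fun b hb ↦ by rw [hB3 b hb, neg_one_zsmul], hB4, hB5⟩

end Main

end Summit.BirchSwinnertonDyer.BirchSwinnertonDyer.Theorems.KolyvaginLowerBoundAtTwo

end
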